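import Literature.AlgebraicGeometry.Resolution.DiffIdealSheaf
import Literature.AlgebraicGeometry.Resolution.SharpOrderCoordinateCentre
import Literature.AlgebraicGeometry.Resolution.DerivativeIdealsBlowup
import Mathlib.AlgebraicGeometry.IdealSheaf.Functorial
import HarnessLib

/-!
# `Diff^{≤ n}` ideal sheaves restrict to opens: `Diff^{≤n}_Y(𝓘)|_X = Diff^{≤n}_X(𝓘|_X)` for an open immersion `X ↪ Y`

Topic `Literature/AlgebraicGeometry/Resolution`; companion of `DiffIdealSheaf.lean` (the ideal sheaves
`diffIdealSheaf φ n 𝓘` of Grothendieck's differential operators of order `≤ n`, EGA IV₄ §16.8, on a scheme whose affine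
pieces are of finite type over a field `K`) and of `DiffIdealSheafSmoothPullback.lean` (the INCLUSION
`ψ^* Diff^{≤n}(𝓘) ⊆ Diff^{≤n}(ψ^*𝓘)` for smooth `ψ`). For an OPEN IMMERSION `f : X ⟶ Y` the pull-back is an EQUALITY:
`(Diff^{≤n}_Y(𝓘)).comap f = Diff^{≤n}_X(𝓘.comap f)` for the induced `K`-structure `f^* ∘ φ` (`comap_diffIdealSheaf_of_isOpenImmersion`).
On an affine open `U ⊆ X`, `f` identifies `Γ(Y, f(U)) ≅ Γ(X, U)` as `K`-algebras (Mathlib `Scheme.Hom.appIso`,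
`IdealSheafData.ideal_comap_of_isOpenImmersion`), both sides have sections `Diff^{≤n}` of the sections
(`diffIdealSheaf_ideal`, EGA IV₄ 16.8.6), and `Diff^{≤n}` is transported by `K`-algebra isomorphisms
(`diffIdeal_map_algEquiv`, `SharpOrderCoordinateCentre.lean`). EGA's form: «pour tout ouvert U de X, D|U … est aussi un
opérateur différentiel d'ordre ≤ n» (16.8.1) — `Diff^n_{X/S}|U = Diff^n_{U/S}`.

Sources: [EGAIV4] (16.8.1) p.40, Prop. (16.8.6) p.41.
-/

noncomputable section

open CategoryTheory AlgebraicGeometry TopologicalSpace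

namespace Literature.AlgebraicGeometry.Resolution

universe u v

section OpenImmersion

variable {K : Type v} [Field K] {X Y : Scheme.{u}} (f : X ⟶ Y) [IsOpenImmersion f] (φ : K →+* Γ(Y, ⊤))

/-- The `K`-algebra isomorphism `Γ(Y, f(U)) ≃ₐ[K] Γ(X, U)` of an open immersion on an affine open `U ⊆ X`, for the
`K`-structures `φ` on `Y` and `f^* ∘ φ` on `X` (Mathlib's `Scheme.Hom.appIso`, which is `f.appLE (f(U)) U`).
[cite: EGAIV4, (16.8.1) p.40 (restriction of the structure to an open)] -/
def sectionsAlgEquivOfIsOpenImmersion (U : X.Opens) :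
    letI := sectionsAlgebra φ (f ''ᵁ U)
    letI := sectionsAlgebra (f.appTop.hom.comp φ) U
    Γ(Y, f ''ᵁ U) ≃ₐ[K] Γ(X, U) :=
  letI := sectionsAlgebra φ (f ''ᵁ U)
  letI := sectionsAlgebra (f.appTop.hom.comp φ) U
  AlgEquiv.ofRingEquiv (f := (f.appIso U).commRingCatIsoToRingEquiv) fun x => by
    change (f.appIso U).hom.hom (sectionsHom φ (f ''ᵁ U) x) = sectionsHom (f.appTop.hom.comp φ) U x
    rw [Scheme.Hom.appIso_hom', ← RingHom.comp_apply,
      appLE_comp_sectionsHom φ f (f ''ᵁ U) U (f.preimage_image_eq U).ge]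

/-- Underlying function of `sectionsAlgEquivOfIsOpenImmersion` = `(f.appIso U).hom`. [cite: EGAIV4, (16.8.1) p.40] -/
theorem sectionsAlgEquivOfIsOpenImmersion_apply (U : X.Opens) (x : Γ(Y, f ''ᵁ U)) :
    sectionsAlgEquivOfIsOpenImmersion f φ U x = (f.appIso U).hom.hom x := rfl

/-- **`Diff^{≤ n}` ideal sheaves restrict to opens**: for an open immersion `f : X ⟶ Y` (affine pieces of finite type over
`K` on both sides) and every ideal sheaf `𝓘` on `Y`, `(Diff^{≤n}_Y(𝓘)).comap f = Diff^{≤n}_X(𝓘.comap f)` for the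
`K`-structure `f^* ∘ φ`. [cite: EGAIV4, (16.8.1) p.40 and Prop. (16.8.6) p.41 (Diff^n is a sheaf: Diff^n_{X/S}|U = Diff^n_{U/S})] -/
theorem comap_diffIdealSheaf_of_isOpenImmersion (hY : HasFiniteTypeSections φ)
    (hX : HasFiniteTypeSections (f.appTop.hom.comp φ)) (n : ℕ) (I : Y.IdealSheafData) :
    (diffIdealSheaf φ n I).comap f = diffIdealSheaf (f.appTop.hom.comp φ) n (I.comap f) := by
  refine Scheme.IdealSheafData.ext (funext fun U => ?_)
  let W : Y.affineOpens := ⟨f ''ᵁ (U : X.Opens), U.2.image_of_isOpenImmersion f⟩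
  rw [Scheme.IdealSheafData.ideal_comap_of_isOpenImmersion, diffIdealSheaf_ideal hX,
    Scheme.IdealSheafData.ideal_comap_of_isOpenImmersion]
  change ((diffIdealSheaf φ n I).ideal W).comap (f.appIso U).inv.hom =
    (letI := sectionsAlgebra (f.appTop.hom.comp φ) U; diffIdeal K n ((I.ideal W).comap (f.appIso U).inv.hom))
  rw [diffIdealSheaf_ideal hY]
  letI := sectionsAlgebra φ W.1
  letI := sectionsAlgebra (f.appTop.hom.comp φ) U.1
  let e := sectionsAlgEquivOfIsOpenImmersion f φ (U : X.Opens)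
  -- `comap` along the inverse of the iso is `map` along the iso
  have hce : ∀ J : Ideal Γ(Y, f ''ᵁ (U : X.Opens)), J.comap (f.appIso U).inv.hom = J.map e := by
    intro J
    ext x
    change e.symm x ∈ J ↔ x ∈ J.map e
    constructor
    · intro hx
      exact (Ideal.mem_map_of_equiv e x).2 ⟨e.symm x, hx, e.apply_symm_apply x⟩
    · intro hx
      obtain ⟨y, hy, rfl⟩ := (Ideal.mem_map_of_equiv e _).1 hx
      rw [e.symm_apply_apply]
      exact hy
  change (diffIdeal K n (I.ideal W)).comap (f.appIso U).inv.hom = diffIdeal K n ((I.ideal W).comap (f.appIso U).inv.hom)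
  rw [hce, hce, diffIdeal_map_algEquiv e]

end OpenImmersion

end Literature.AlgebraicGeometry.Resolution

end
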